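import Mathlib
import Literature.Analysis.FluidPDE.LocalLerayPairingContinuity
import Literature.Analysis.FluidPDE.SelfSimilarCollapseAnsatz
import Summits.NavierStokesRegularity.NavierStokesRegularity.Theorems.EulerZoomLiouvillePowerGaugeEulerLiouvilleSelfSimilarLEI
import Summits.NavierStokesRegularity.NavierStokesRegularity.Theorems.EulerZoomLiouvillePowerGaugeEulerLiouvilleSelfSimilarTransfer
import Summits.NavierStokesRegularity.NavierStokesRegularity.Theorems.EulerZoomLiouvillePowerGaugeEulerLiouvilleProfileEnergyTools
import HarnessLib

/-!
# The weak self-similar Euler profile equation, I: the rescaled test field and the slab Fubini lemma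
# (crux `EulerZoomLiouville.PowerGaugeEulerLiouville` = stmt-NavierStokesRegularity-19832, line `birth`, rung C1)

Route `EulerZoomLiouville` (NavierStokesRegularity).  Tools for testing the distributional Euler identity of an
exactly self-similar member with the RESCALED space–time test field `Ψ(t,x) = χ(t) θ((−t)^{−γ}x)`
(`χ ∈ C_c^∞((a,b))`, `b < 0`, `θ` a test function): `Ψ` is a space–time test field on the slab
(`isSpaceTimeTestOn_rescaled`: smooth by the two-open-sets argument, compactly supported in
`[a,b] × B̄(0, R_θ((−a)^γ + (−b)^γ))`); its slice derivative, divergence and time derivative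
(`fderiv_rescaled_slice`, `divergence_rescaled_slice`, `timeDeriv_rescaled`); the 1-D integration by parts
`∫χ'(−t)^e = e∫χ(−t)^{e−1}` (`integral_deriv_mul_neg_rpow`); the slab Fubini lemma
`∫∫ α(t) g((−t)^{−γ}x) dx dt = (∫α(t)(−t)^{3γ}dt)(∫g)` (`integral_slab_mul_comp_dilation`); and the pointwise
form of the tested integrand of a self-similar pair (`tested_integrand_selfSimilar`).

Context.  The crux's class members are distributional Euler pairs on the slab `(−∞,0) × ℝ³`; the lineage's
self-similar dictionary (`…SelfSimilarLEI/Gauges/Pressure/Gradient/Transfer`) transfers the local energy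
INEQUALITY and the three gauges to the profile, but not the Euler identity itself.  This pair of files transfers
the MOMENTUM IDENTITY: an exactly self-similar member `u(t) = selfSimilarCollapse γ 0 V t`,
`p(t) = selfSimilarCollapsePressure γ 0 P t` has a profile solving the self-similar Euler profile equation
`(1−γ)V + γ(y·∇)V + (V·∇)V + ∇P = 0` in the sense of distributions, and `V` is weakly divergence free — the
inputs of the profile local energy EQUALITY `ProfileEnergy.profile_local_energy_equality` (critic-2 K3: the
residue of the crux needs a lever that uses the Euler identity).  WHAT THIS IS NOT: not NS regularity, not the
crux; a C1 dictionary entry `--supports` stmt-19832. [folklore]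
-/

noncomputable section

set_option linter.dupNamespace false

open MeasureTheory Set Filter Topology Metric Function TopologicalSpace
open scoped ENNReal NNReal RealInnerProductSpace ContDiff

namespace Summit.NavierStokesRegularity.NavierStokesRegularity.Theorems.PowerGaugeEulerLiouville

open Literature.Analysis Literature.Analysis.FunctionSpaces Literature.Analysis.FluidPDE

namespace ProfileEquation

/-! ## The rescaled space–time test field `Ψ(t,x) = χ(t) θ((−t)^{−γ} x)` -/

section Rescaled

variable {F : Type*} [NormedAddCommGroup F] [NormedSpace ℝ F]

/-- `t ↦ (−t)^q` is smooth at every `t < 0`. [folklore] -/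
theorem contDiffAt_neg_rpow {t : ℝ} (ht : t < 0) (q : ℝ) {n : ℕ∞} :
    ContDiffAt ℝ n (fun s : ℝ => (-s) ^ q) t :=
  (contDiffAt_id.neg).rpow_const_of_ne (by simp [ht.ne])

/-- **The rescaled space–time test field is a test field on the slab `(−∞,0) × ℝ³`.**  For `χ`
smooth with `tsupport χ ⊆ (a, b)`, `b < 0`, and a test function `θ` on `ℝ³`,
`Ψ(t, x) = χ(t) θ((−t)^{−γ} x)` is smooth with compact support inside the slab. [folklore] -/
theorem isSpaceTimeTestOn_rescaled {γ a b : ℝ} (hb : b < 0) {χ : ℝ → ℝ} (hχ : ContDiff ℝ (⊤ : ℕ∞) χ)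
    (hχI : tsupport χ ⊆ Ioo a b) {θ : EuclideanSpace ℝ (Fin 3) → F}
    (hθ : IsTestFunctionOn (⊤ : Opens (EuclideanSpace ℝ (Fin 3))) θ) :
    IsSpaceTimeTestOn (slab (EuclideanSpace ℝ (Fin 3)) (Iio 0) isOpen_Iio)
      (fun t x => χ t • θ ((-t) ^ (-γ) • x)) := by
  -- smoothness
  have hχ0 : ∀ t, b ≤ t → χ t = 0 := fun t ht =>
    image_eq_zero_of_notMem_tsupport fun h => (not_lt.2 ht) (hχI h).2
  have hsmooth : ContDiff ℝ (⊤ : ℕ∞) (uncurry fun t x => χ t • θ ((-t) ^ (-γ) • x)) := by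
    rw [contDiff_iff_contDiffAt]
    rintro ⟨t, x⟩
    by_cases ht : t < 0
    · -- the explicit smooth expression
      have h1 : ContDiffAt ℝ (⊤ : ℕ∞) (fun z : ℝ × EuclideanSpace ℝ (Fin 3) => χ z.1) (t, x) :=
        (hχ.contDiffAt).comp (t, x) contDiffAt_fst
      have h2 : ContDiffAt ℝ (⊤ : ℕ∞) (fun z : ℝ × EuclideanSpace ℝ (Fin 3) => (-z.1) ^ (-γ) • z.2) (t, x) :=
        ((contDiffAt_neg_rpow ht (-γ)).comp (t, x) contDiffAt_fst).smul contDiffAt_snd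
      have h3 : ContDiffAt ℝ (⊤ : ℕ∞) (fun z : ℝ × EuclideanSpace ℝ (Fin 3) => θ ((-z.1) ^ (-γ) • z.2)) (t, x) :=
        hθ.contDiff.contDiffAt.comp (t, x) h2
      exact h1.smul h3
    · -- near `t ≥ 0 > b` the field vanishes identically
      have hev : (uncurry fun t x => χ t • θ ((-t) ^ (-γ) • x)) =ᶠ[𝓝 (t, x)]
          fun _ => (0 : F) := by
        have hopen : IsOpen {z : ℝ × EuclideanSpace ℝ (Fin 3) | b < z.1} := isOpen_lt continuous_const continuous_fst
        have hmem : (t, x) ∈ {z : ℝ × EuclideanSpace ℝ (Fin 3) | b < z.1} := lt_of_lt_of_le hb (not_lt.1 ht)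
        filter_upwards [hopen.mem_nhds hmem] with z hz
        simp only [uncurry, hχ0 z.1 (le_of_lt hz), zero_smul]
      exact (contDiffAt_const.congr_of_eventuallyEq hev)
  -- compact support
  obtain ⟨Rθ, hRθ⟩ := (hθ.hasCompactSupport.isCompact.isBounded).subset_closedBall (0 : EuclideanSpace ℝ (Fin 3))
  set R' : ℝ := |Rθ| * ((-a) ^ γ + (-b) ^ γ) with hR'
  have hsupp : support (uncurry fun t x => χ t • θ ((-t) ^ (-γ) • x)) ⊆
      Icc a b ×ˢ closedBall (0 : EuclideanSpace ℝ (Fin 3)) R' := by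
    rintro ⟨t, x⟩ hz
    rw [mem_support] at hz
    simp only [uncurry] at hz
    have hχt : χ t ≠ 0 := fun h => hz (by rw [h, zero_smul])
    have hθx : θ ((-t) ^ (-γ) • x) ≠ 0 := fun h => hz (by rw [h, smul_zero])
    have htI : t ∈ Ioo a b := hχI (subset_tsupport _ (mem_support.2 hχt))
    have ht0 : 0 < -t := by linarith [htI.2]
    have hy : ‖(-t) ^ (-γ) • x‖ ≤ Rθ := by
      have := hRθ (subset_tsupport _ (mem_support.2 hθx))
      rwa [mem_closedBall, dist_zero_right] at this
    refine ⟨Ioo_subset_Icc_self htI, ?_⟩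
    rw [mem_closedBall, dist_zero_right]
    have hx : x = (-t) ^ γ • ((-t) ^ (-γ) • x) := (rpow_smul_rpow_neg_smul ht0 γ x).symm
    have hpow : (-t) ^ γ ≤ (-a) ^ γ + (-b) ^ γ := by
      rcases le_total 0 γ with hγ | hγ
      · have h1 : (-t) ^ γ ≤ (-a) ^ γ :=
          Real.rpow_le_rpow ht0.le (by linarith [htI.1]) hγ
        linarith [Real.rpow_nonneg (show (0 : ℝ) ≤ -b by linarith) γ]
      · have h1 : (-t) ^ γ ≤ (-b) ^ γ :=
          Real.rpow_le_rpow_of_nonpos (by linarith) (by linarith [htI.2]) hγ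
        linarith [Real.rpow_nonneg (show (0 : ℝ) ≤ -a by linarith [htI.1]) γ]
    calc ‖x‖ = ‖(-t) ^ γ • ((-t) ^ (-γ) • x)‖ := by rw [← hx]
      _ = (-t) ^ γ * ‖(-t) ^ (-γ) • x‖ := by
          rw [norm_smul, Real.norm_of_nonneg (Real.rpow_nonneg ht0.le γ)]
      _ ≤ ((-a) ^ γ + (-b) ^ γ) * |Rθ| :=
          mul_le_mul hpow (hy.trans (le_abs_self _)) (norm_nonneg _)
            (add_nonneg (Real.rpow_nonneg (by linarith [htI.1]) γ) (Real.rpow_nonneg (by linarith [htI.2]) γ))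
      _ = R' := by rw [hR']; ring
  have hK : IsCompact (Icc a b ×ˢ closedBall (0 : EuclideanSpace ℝ (Fin 3)) R') :=
    isCompact_Icc.prod (isCompact_closedBall _ _)
  refine ⟨hsmooth, HasCompactSupport.of_support_subset_isCompact hK hsupp, ?_⟩
  -- support inside the slab
  intro z hz
  have hz' : z ∈ Icc a b ×ˢ closedBall (0 : EuclideanSpace ℝ (Fin 3)) R' :=
    closure_minimal hsupp (hK.isClosed) hz
  rw [coe_slab]
  exact ⟨lt_of_le_of_lt hz'.1.2 hb, mem_univ _⟩

/-- Spatial derivative of the rescaled field on a slice: `D_x Ψ(t,·)(x) v = χ(t) (−t)^{−γ} Dθ(y) v`,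
`y = (−t)^{−γ} x`. [folklore] -/
theorem fderiv_rescaled_slice {γ : ℝ} (χ : ℝ → ℝ) {θ : EuclideanSpace ℝ (Fin 3) → F}
    (hθ : Differentiable ℝ θ) (t : ℝ) (x v : EuclideanSpace ℝ (Fin 3)) :
    fderiv ℝ (fun x => χ t • θ ((-t) ^ (-γ) • x)) x v =
      χ t • ((-t) ^ (-γ) • fderiv ℝ θ ((-t) ^ (-γ) • x) v) := by
  have h1 : HasFDerivAt (fun x : EuclideanSpace ℝ (Fin 3) => (-t) ^ (-γ) • x)
      ((-t) ^ (-γ) • ContinuousLinearMap.id ℝ (EuclideanSpace ℝ (Fin 3))) x :=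
    (hasFDerivAt_id x).const_smul ((-t) ^ (-γ))
  have h2 : HasFDerivAt (fun x => χ t • θ ((-t) ^ (-γ) • x))
      (χ t • (fderiv ℝ θ ((-t) ^ (-γ) • x)).comp ((-t) ^ (-γ) • ContinuousLinearMap.id ℝ (EuclideanSpace ℝ (Fin 3)))) x :=
    ((hθ ((-t) ^ (-γ) • x)).hasFDerivAt.comp x h1).const_smul (χ t)
  rw [h2.fderiv]
  simp

/-- Divergence of the rescaled field on a slice: `div_x Ψ(t,·)(x) = χ(t) (−t)^{−γ} div θ(y)`. [folklore] -/
theorem divergence_rescaled_slice {γ : ℝ} (χ : ℝ → ℝ)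
    {θ : EuclideanSpace ℝ (Fin 3) → EuclideanSpace ℝ (Fin 3)} (hθ : Differentiable ℝ θ) (t : ℝ)
    (x : EuclideanSpace ℝ (Fin 3)) :
    VectorCalculus.divergence (fun x => χ t • θ ((-t) ^ (-γ) • x)) x =
      χ t * ((-t) ^ (-γ) * VectorCalculus.divergence θ ((-t) ^ (-γ) • x)) := by
  have h1 : HasFDerivAt (fun x : EuclideanSpace ℝ (Fin 3) => (-t) ^ (-γ) • x)
      ((-t) ^ (-γ) • ContinuousLinearMap.id ℝ (EuclideanSpace ℝ (Fin 3))) x :=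
    (hasFDerivAt_id x).const_smul ((-t) ^ (-γ))
  have h2 : HasFDerivAt (fun x => χ t • θ ((-t) ^ (-γ) • x))
      (χ t • (fderiv ℝ θ ((-t) ^ (-γ) • x)).comp ((-t) ^ (-γ) • ContinuousLinearMap.id ℝ (EuclideanSpace ℝ (Fin 3)))) x :=
    ((hθ ((-t) ^ (-γ) • x)).hasFDerivAt.comp x h1).const_smul (χ t)
  unfold VectorCalculus.divergence
  rw [h2.fderiv]
  simp

/-- Time derivative of the rescaled field at `t < 0`:
`∂ₜΨ(t,x) = χ'(t) θ(y) + χ(t) γ (−t)^{−1} Dθ(y) y`, `y = (−t)^{−γ} x`. [folklore] -/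
theorem timeDeriv_rescaled {γ : ℝ} {χ : ℝ → ℝ} (hχ : Differentiable ℝ χ)
    {θ : EuclideanSpace ℝ (Fin 3) → F} (hθ : Differentiable ℝ θ) {t : ℝ} (ht : t < 0)
    (x : EuclideanSpace ℝ (Fin 3)) :
    timeDeriv (fun t x => χ t • θ ((-t) ^ (-γ) • x)) t x =
      deriv χ t • θ ((-t) ^ (-γ) • x) +
        χ t • ((γ * (-t) ^ (-1 : ℝ)) • fderiv ℝ θ ((-t) ^ (-γ) • x) ((-t) ^ (-γ) • x)) := by
  rw [timeDeriv_apply]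
  have ht0 : 0 < -t := neg_pos.2 ht
  -- the inner curve `s ↦ (−s)^{−γ} • x`
  have hpow : HasDerivAt (fun s : ℝ => (-s) ^ (-γ)) (-(-γ) * (-t) ^ (-γ - 1)) t := by
    have h1 : HasDerivAt (fun s : ℝ => -s) (-1) t := hasDerivAt_neg t
    have h2 := h1.rpow_const (p := -γ) (Or.inl (neg_pos.2 ht).ne')
    convert h2 using 1
    ring
  have hin : HasDerivAt (fun s : ℝ => (-s) ^ (-γ) • x) ((-(-γ) * (-t) ^ (-γ - 1)) • x) t :=
    hpow.smul_const x
  have hcomp : HasDerivAt (fun s : ℝ => θ ((-s) ^ (-γ) • x))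
      (fderiv ℝ θ ((-t) ^ (-γ) • x) ((-(-γ) * (-t) ^ (-γ - 1)) • x)) t :=
    (hθ ((-t) ^ (-γ) • x)).hasFDerivAt.comp_hasDerivAt t hin
  have h : HasDerivAt (fun s : ℝ => χ s • θ ((-s) ^ (-γ) • x))
      (χ t • fderiv ℝ θ ((-t) ^ (-γ) • x) ((-(-γ) * (-t) ^ (-γ - 1)) • x) +
        deriv χ t • θ ((-t) ^ (-γ) • x)) t :=
    (hχ t).hasDerivAt.smul hcomp
  rw [h.deriv]
  have e : (-(-γ) * (-t) ^ (-γ - 1)) • x = (γ * (-t) ^ (-1 : ℝ)) • ((-t) ^ (-γ) • x) := by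
    rw [smul_smul, show -γ - 1 = (-1 : ℝ) + -γ by ring, Real.rpow_add ht0]
    ring_nf
  rw [e, map_smul, add_comm]

end Rescaled

/-! ## One-dimensional and slab integration tools -/

section SlabTools

/-- **The 1-D integration by parts behind the profile equation**: for `χ` smooth with
`tsupport χ ⊆ (a,b)`, `b < 0`, and any exponent `e`,
`∫ χ'(t) (−t)^e dt = e ∫ χ(t) (−t)^{e−1} dt`. [folklore] -/
theorem integral_deriv_mul_neg_rpow {a b : ℝ} (hb : b < 0) {χ : ℝ → ℝ} (hχ : ContDiff ℝ (⊤ : ℕ∞) χ)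
    (hχc : HasCompactSupport χ) (hχI : tsupport χ ⊆ Ioo a b) (e : ℝ) :
    ∫ t, deriv χ t * (-t) ^ e = e * ∫ t, χ t * (-t) ^ (e - 1) := by
  have hχd : Differentiable ℝ χ := hχ.differentiable (by simp)
  have hχ'c : Continuous (deriv χ) := hχ.continuous_deriv (by simp)
  have hχ0 : ∀ t, b ≤ t → χ t = 0 := fun t ht =>
    image_eq_zero_of_notMem_tsupport fun h => (not_lt.2 ht) (hχI h).2
  have hχ'0 : ∀ t, t ∉ tsupport χ → deriv χ t = 0 := fun t ht => by
    by_contra hne; exact ht (support_deriv_subset (mem_support.2 hne))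
  -- `w = χ (−t)^e` and its derivative
  set w : ℝ → ℝ := fun t => χ t * (-t) ^ e with hw
  set w' : ℝ → ℝ := fun t => deriv χ t * (-t) ^ e - e * (χ t * (-t) ^ (e - 1)) with hw'
  have hderiv : ∀ t, HasDerivAt w (w' t) t := by
    intro t
    by_cases ht : t < 0
    · have hpow : HasDerivAt (fun s : ℝ => (-s) ^ e) (-e * (-t) ^ (e - 1)) t := by
        have h1 : HasDerivAt (fun s : ℝ => -s) (-1) t := hasDerivAt_neg t
        have h2 := h1.rpow_const (p := e) (Or.inl (neg_pos.2 ht).ne')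
        convert h2 using 1
        ring
      have h := ((hχd t).hasDerivAt).mul hpow
      refine h.congr_deriv ?_
      simp only [hw']; ring
    · -- `w ≡ 0` near `t ≥ 0 > b`
      have hev : w =ᶠ[𝓝 t] fun _ => 0 := by
        filter_upwards [(isOpen_lt continuous_const continuous_id).mem_nhds
          (show b < t from lt_of_lt_of_le hb (not_lt.1 ht))] with s hs
        simp only [hw, hχ0 s hs.le, zero_mul]
      have h0 : HasDerivAt w 0 t := (hasDerivAt_const t (0 : ℝ)).congr_of_eventuallyEq hev
      have ht' : t ∉ tsupport χ := fun h => ht ((hχI h).2.trans hb)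
      have : w' t = 0 := by
        simp only [hw', hχ'0 t ht', image_eq_zero_of_notMem_tsupport ht', zero_mul, mul_zero, sub_zero]
      rw [this]; exact h0
  -- everything is continuous with compact support, hence integrable
  have hK : IsCompact (Icc a b) := isCompact_Icc
  have hwsupp : support w ⊆ Icc a b := by
    intro t ht
    rw [mem_support] at ht
    have : χ t ≠ 0 := fun h => ht (by simp only [hw, h, zero_mul])
    exact Ioo_subset_Icc_self (hχI (subset_tsupport _ (mem_support.2 this)))
  have hpow_cont : ∀ q : ℝ, ContinuousOn (fun t : ℝ => (-t) ^ q) (Iio 0) := fun q t ht =>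
    ((contDiffAt_neg_rpow ht q (n := 0)).continuousAt).continuousWithinAt
  -- continuity of `w`, `w'` (products with factors vanishing near `t ≥ b`)
  have hcont_mul : ∀ {g : ℝ → ℝ}, Continuous g → (∀ t, b ≤ t → g t = 0) → ∀ q : ℝ,
      Continuous fun t => g t * (-t) ^ q := by
    intro g hg hg0 q
    rw [continuous_iff_continuousAt]
    intro t
    by_cases ht : t < 0
    · exact (hg.continuousAt).mul ((contDiffAt_neg_rpow ht q (n := 0)).continuousAt)
    · have hev : (fun s => g s * (-s) ^ q) =ᶠ[𝓝 t] fun _ => 0 := by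
        filter_upwards [(isOpen_lt continuous_const continuous_id).mem_nhds
          (show b < t from lt_of_lt_of_le hb (not_lt.1 ht))] with s hs
        simp only [hg0 s hs.le, zero_mul]
      exact (continuousAt_const.congr_of_eventuallyEq hev)
  have hχ'0b : ∀ t, b ≤ t → deriv χ t = 0 := fun t ht => hχ'0 t fun h => (not_lt.2 ht) (hχI h).2
  have hwc : Continuous w := hcont_mul hχ.continuous hχ0 e
  have hc1 : Continuous fun t => deriv χ t * (-t) ^ e := hcont_mul hχ'c hχ'0b e
  have hc2 : Continuous fun t => χ t * (-t) ^ (e - 1) := hcont_mul hχ.continuous hχ0 (e - 1)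
  have hw'c : Continuous w' := hc1.sub (continuous_const.mul hc2)
  have hsupp1 : HasCompactSupport fun t => deriv χ t * (-t) ^ e :=
    (hχc.deriv).mul_right
  have hsupp2 : HasCompactSupport fun t => χ t * (-t) ^ (e - 1) := hχc.mul_right
  have hwi : Integrable w := hwc.integrable_of_hasCompactSupport hχc.mul_right
  have hi1 : Integrable fun t => deriv χ t * (-t) ^ e := hc1.integrable_of_hasCompactSupport hsupp1
  have hi2 : Integrable fun t => χ t * (-t) ^ (e - 1) := hc2.integrable_of_hasCompactSupport hsupp2
  have hw'i : Integrable w' := hi1.sub (hi2.const_mul e)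
  have h0 := integral_eq_zero_of_hasDerivAt_of_integrable hderiv hw'i hwi
  simp only [hw'] at h0
  rw [integral_sub hi1 (hi2.const_mul e), integral_const_mul] at h0
  linarith

/-- A product `g(t) (−t)^q` with `g` continuous and vanishing for `t ≥ b` (`b < 0`) is continuous on `ℝ`
(the power is only evaluated where `−t > 0`). [folklore] -/
theorem continuous_mul_neg_rpow {b : ℝ} (hb : b < 0) {g : ℝ → ℝ} (hg : Continuous g)
    (hg0 : ∀ t, b ≤ t → g t = 0) (q : ℝ) : Continuous fun t => g t * (-t) ^ q := by
  rw [continuous_iff_continuousAt]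
  intro t
  by_cases ht : t < 0
  · exact (hg.continuousAt).mul ((contDiffAt_neg_rpow ht q (n := 0)).continuousAt)
  · have hev : (fun s => g s * (-s) ^ q) =ᶠ[𝓝 t] fun _ => 0 := by
      filter_upwards [(isOpen_lt continuous_const continuous_id).mem_nhds
        (show b < t from lt_of_lt_of_le hb (not_lt.1 ht))] with s hs
      simp only [hg0 s hs.le, zero_mul]
    exact (continuousAt_const.congr_of_eventuallyEq hev)

/-- **Fubini for one dilated term on the slab.**  For `g ∈ L¹(ℝ³)` and a continuous weight `α`
supported in `(a, b)`, `b < 0`: the function `(t, x) ↦ α(t) g((−t)^{−γ} x)` is integrable on the slab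
`(−∞,0) × ℝ³` and `∫∫ α(t) g((−t)^{−γ}x) dx dt = (∫ α(t)(−t)^{3γ} dt)(∫ g)`. [folklore] -/
theorem integral_slab_mul_comp_dilation {γ a b : ℝ} (hb : b < 0) {g : EuclideanSpace ℝ (Fin 3) → ℝ}
    (hg : Integrable g volume) {α : ℝ → ℝ} (hα : Continuous α) (hαs : support α ⊆ Ioo a b) :
    Integrable (fun z : ℝ × EuclideanSpace ℝ (Fin 3) => α z.1 * g ((-z.1) ^ (-γ) • z.2))
        (volume.restrict (Iio (0 : ℝ) ×ˢ (univ : Set (EuclideanSpace ℝ (Fin 3))))) ∧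
      ∫ z in Iio (0 : ℝ) ×ˢ (univ : Set (EuclideanSpace ℝ (Fin 3))), α z.1 * g ((-z.1) ^ (-γ) • z.2) =
        (∫ t, α t * (-t) ^ (3 * γ)) * ∫ y, g y := by
  have hα0 : ∀ t, t ∉ Ioo a b → α t = 0 := fun t ht => notMem_support.1 fun h => ht (hαs h)
  have hα0' : ∀ t, b ≤ t → α t = 0 := fun t ht => hα0 t fun h => (not_lt.2 ht) h.2
  -- measurability on the slab measure
  have hmeas : AEStronglyMeasurable (fun z : ℝ × EuclideanSpace ℝ (Fin 3) => α z.1 * g ((-z.1) ^ (-γ) • z.2))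
      (((volume : Measure ℝ).restrict (Iio 0)).prod volume) := by
    have h1 : AEStronglyMeasurable (fun z : ℝ × EuclideanSpace ℝ (Fin 3) => g ((-z.1) ^ (-γ) • z.2))
        (((volume : Measure ℝ).restrict (Iio 0)).prod volume) :=
      hg.1.comp_quasiMeasurePreserving (quasiMeasurePreserving_selfSimilarDilation γ)
    exact ((hα.comp continuous_fst).aestronglyMeasurable).mul h1
  -- slices and the norm integral
  have hslice : ∀ t : ℝ, t < 0 → ∫ x, g ((-t) ^ (-γ) • x) = (-t) ^ (3 * γ) * ∫ y, g y := by
    intro t ht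
    have key := Measure.integral_comp_smul (volume : Measure (EuclideanSpace ℝ (Fin 3))) g ((-t) ^ (-γ))
    rw [key, finrank_euclideanSpace_fin, abs_inv_rpow_neg_pow_three (neg_pos.2 ht), smul_eq_mul]
  have hslice_norm : ∀ t : ℝ, t < 0 → ∫ x, ‖g ((-t) ^ (-γ) • x)‖ = (-t) ^ (3 * γ) * ∫ y, ‖g y‖ := by
    intro t ht
    have key := Measure.integral_comp_smul (volume : Measure (EuclideanSpace ℝ (Fin 3))) (fun y => ‖g y‖) ((-t) ^ (-γ))
    rw [key, finrank_euclideanSpace_fin, abs_inv_rpow_neg_pow_three (neg_pos.2 ht), smul_eq_mul]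
  have hint : Integrable (fun z : ℝ × EuclideanSpace ℝ (Fin 3) => α z.1 * g ((-z.1) ^ (-γ) • z.2))
      (((volume : Measure ℝ).restrict (Iio 0)).prod volume) := by
    rw [integrable_prod_iff hmeas]
    constructor
    · filter_upwards [ae_restrict_mem measurableSet_Iio] with t ht
      exact (hg.comp_smul (Real.rpow_pos_of_pos (neg_pos.2 ht) _).ne').const_mul _
    · -- `t ↦ ∫ ‖α t g((−t)^{−γ}x)‖ dx = |α t| (−t)^{3γ} ‖g‖₁` is continuous with compact support
      have hc : Continuous fun t => |α t| * (-t) ^ (3 * γ) := by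
        have := continuous_mul_neg_rpow hb (continuous_abs.comp hα) (fun t ht => by
          simp [hα0' t ht]) (3 * γ)
        exact this
      have hcs : HasCompactSupport fun t => |α t| * (-t) ^ (3 * γ) := by
        refine HasCompactSupport.of_support_subset_isCompact isCompact_Icc (K := Icc a b) ?_
        intro t ht
        rw [mem_support] at ht
        have : α t ≠ 0 := fun h => ht (by simp [h])
        exact Ioo_subset_Icc_self (hαs (mem_support.2 this))
      have hi : Integrable (fun t => |α t| * (-t) ^ (3 * γ) * ∫ y, ‖g y‖) volume :=
        (hc.integrable_of_hasCompactSupport hcs).mul_const _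
      refine (hi.restrict (s := Iio 0)).congr ?_
      filter_upwards [ae_restrict_mem measurableSet_Iio] with t ht
      have e : (fun x => ‖α t * g ((-t) ^ (-γ) • x)‖) = fun x => |α t| * ‖g ((-t) ^ (-γ) • x)‖ := by
        funext x; rw [norm_mul, Real.norm_eq_abs]
      rw [e, integral_const_mul, hslice_norm t ht]
      ring
  -- Fubini
  have hμ : (volume : Measure (ℝ × EuclideanSpace ℝ (Fin 3))).restrict
      (Iio (0 : ℝ) ×ˢ (univ : Set (EuclideanSpace ℝ (Fin 3)))) =
      ((volume : Measure ℝ).restrict (Iio 0)).prod volume := by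
    rw [Measure.volume_eq_prod, ← Measure.restrict_prod_eq_prod_univ]
  refine ⟨by rw [hμ]; exact hint, ?_⟩
  rw [hμ, integral_prod _ hint]
  have hae : ∀ᵐ t ∂((volume : Measure ℝ).restrict (Iio 0)),
      (∫ x, α t * g ((-t) ^ (-γ) • x)) = α t * (-t) ^ (3 * γ) * ∫ y, g y := by
    filter_upwards [ae_restrict_mem measurableSet_Iio] with t ht
    rw [integral_const_mul, hslice t ht, mul_assoc]
  rw [integral_congr_ae hae, integral_mul_const]
  congr 1
  -- `∫_{t<0} = ∫_ℝ` since the integrand vanishes for `t ≥ 0`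
  refine setIntegral_eq_integral_of_forall_compl_eq_zero fun t ht => ?_
  have ht' : 0 ≤ t := not_lt.1 ht
  rw [hα0' t (hb.le.trans ht'), zero_mul]

/-- **The tested integrand of an exactly self-similar pair, pointwise** (`t < 0`): with
`Ψ(t,x) = χ(t) η((−t)^{−γ}x)`, `u(t) = selfSimilarCollapse γ 0 V t`, `p(t) = selfSimilarCollapsePressure γ 0 P t`
and `y = (−t)^{−γ} x`,
`⟪u, ∂ₜΨ⟫ + ⟪u, DΨ(u)⟫ + p div Ψ = χ'(t)(−t)^{γ−1}⟪V y, η y⟫ + γχ(t)(−t)^{γ−2}⟪V y, Dη(y) y⟫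
  + χ(t)(−t)^{γ−2}(⟪V y, Dη(y)(V y)⟫ + P y div η y)`. [folklore] -/
theorem tested_integrand_selfSimilar {γ : ℝ} {χ : ℝ → ℝ} (hχ : Differentiable ℝ χ)
    {η : EuclideanSpace ℝ (Fin 3) → EuclideanSpace ℝ (Fin 3)} (hη : Differentiable ℝ η)
    (V : EuclideanSpace ℝ (Fin 3) → EuclideanSpace ℝ (Fin 3)) (P : EuclideanSpace ℝ (Fin 3) → ℝ)
    {t : ℝ} (ht : t < 0) (x : EuclideanSpace ℝ (Fin 3)) :
    ⟪selfSimilarCollapse γ 0 V t x, timeDeriv (fun t x => χ t • η ((-t) ^ (-γ) • x)) t x⟫ +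
        ⟪selfSimilarCollapse γ 0 V t x,
          fderiv ℝ (fun x => χ t • η ((-t) ^ (-γ) • x)) x (selfSimilarCollapse γ 0 V t x)⟫ +
        selfSimilarCollapsePressure γ 0 P t x *
          VectorCalculus.divergence (fun x => χ t • η ((-t) ^ (-γ) • x)) x =
      deriv χ t * (-t) ^ (γ - 1) * ⟪V ((-t) ^ (-γ) • x), η ((-t) ^ (-γ) • x)⟫ +
        γ * (χ t * (-t) ^ (γ - 2)) *
          ⟪V ((-t) ^ (-γ) • x), fderiv ℝ η ((-t) ^ (-γ) • x) ((-t) ^ (-γ) • x)⟫ +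
        χ t * (-t) ^ (γ - 2) *
          (⟪V ((-t) ^ (-γ) • x), fderiv ℝ η ((-t) ^ (-γ) • x) (V ((-t) ^ (-γ) • x))⟫ +
            P ((-t) ^ (-γ) • x) * VectorCalculus.divergence η ((-t) ^ (-γ) • x)) := by
  have hs : 0 < -t := neg_pos.2 ht
  rw [timeDeriv_rescaled hχ hη ht, fderiv_rescaled_slice χ hη, divergence_rescaled_slice χ hη,
    selfSimilarCollapse_apply, selfSimilarCollapsePressure_apply, zero_sub]
  -- the power identities
  have e1 : (-t) ^ (γ - 1) * (γ * (-t) ^ (-1 : ℝ)) = γ * (-t) ^ (γ - 2) := by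
    rw [show γ - 2 = γ - 1 + (-1 : ℝ) by ring, Real.rpow_add hs]; ring
  have e2 : (-t) ^ (γ - 1) * ((-t) ^ (-γ) * (-t) ^ (γ - 1)) = (-t) ^ (γ - 2) := by
    rw [← Real.rpow_add hs, ← Real.rpow_add hs]; congr 1; ring
  have e3 : (-t) ^ (2 * (γ - 1)) * (-t) ^ (-γ) = (-t) ^ (γ - 2) := by
    rw [← Real.rpow_add hs]; congr 1; ring
  simp only [inner_add_right, inner_smul_left, inner_smul_right, map_smul, RCLike.conj_to_real]
  linear_combination
    (χ t * (-t) ^ (-γ) * ⟪V ((-t) ^ (-γ) • x), fderiv ℝ η ((-t) ^ (-γ) • x) x⟫) * e1 +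
      (χ t * ⟪V ((-t) ^ (-γ) • x), fderiv ℝ η ((-t) ^ (-γ) • x) (V ((-t) ^ (-γ) • x))⟫) * e2 +
      (χ t * P ((-t) ^ (-γ) • x) * VectorCalculus.divergence η ((-t) ^ (-γ) • x)) * e3

end SlabTools

end ProfileEquation

end Summit.NavierStokesRegularity.NavierStokesRegularity.Theorems.PowerGaugeEulerLiouville
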